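import Summits.QuantumFields.YangMills.Theorems.UnitScaleTiltProp7PA2HoldsT3
import Summits.QuantumFields.YangMills.Theorems.UnitScaleTiltProp7HN06OfPatch
import HarnessLib

/-!
# Route `UnitScaleTilt`, crux K1 «MinimiserStabilityRegPr» (stmt-QuantumFields-19200), E′ growth side — **THE GROWTH ROW (141)–(142) `hcoS` FROM THE PATCH SCHEMA ALONE**
# (architecture (A′) «`hcoS` ⟸ (N06)ᶜ ∧ (β)» with (β) CLOSED ✓p724900 and (N06)ᶜ ⟸ `hPatch@H_door` by ★p1 g20's lane-II terminal knit)

Cell `ym3-torus`, twin-width seat `ym-routeR-w1` (gen 11; (β)-lane pen-namer, PEN WORD №3 on ★p1 g20's word).  THEOREMS ONLY (0 `def`, 0 `sorry`, 0 `instance`); default heartbeats;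
`--supports stmt-QuantumFields-19200 --as helper`, count-neutral.  YM₃ on T³ is a ladder rung (R3), NOT the Clay problem; nothing here claims the stub `stub_existenceMinimalOrbit`,
the crux, `hPatch`, d = 4 or the mass gap.

WHY.  ★p1 g18's architecture (A′) reads the E′ growth socket `hcoS` ([Balaban1985Variational] (141)–(142): the Wilson action does not decrease along the chart `X ↦ emb15 W (e^{iX})`
at a printed-regular `W` on the fibre, for Σ-representatives in the (19)-window with the averaging and projected-Landau conditions) from TWO labelled rows, (N06)ᶜ `hN06` and (β) `hD`
(✓`Prop7HcoSOfNormG0DiffRow.hcoS_of_normG0_of_diffL1`).  (β) is a tree theorem since ✓p724900 (`Prop7PA2Holds.hD_holds`, whence `hcoS_of_hN06`); (N06)ᶜ is, by ★p1 g20's lane-II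
terminal knit ✓`Prop7HN06OfPatch.hN06_of_patch`, a consequence of ONE displayed hypothesis — the member-geometry patch schema `hPatch` (v2, floor `s₀`) at the door functional
`H := H_door` (six of the seven lane-II rows being tree theorems by name: ✓`hEng_of_rlegs` ∘ ✓`rlegs_of_regPr`, ✓`hH0_doorH`, ✓`hHsplit_doorH`, ✓`h𝔰𝔲_doorH_of_rlegs`,
✓`hcen_doorH_of_flat` ∘ ✓`hcen_one`, with ✓`exists_smoothRightInverse_QprimeCombL2`, ✓`coarse_rows`, ✓`member_core_row_packaged`, ✓`hQH1_of_sectors`, (E1) v2 plumbing).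
Composing the two: **`hcoS` ⟸ `hPatch@H_door`** — one term; the `hN06` texts agree token for token (★p1 authored both sides; script-checked 639∕639).

WHAT THIS IS NOT.  Not a proof of `hPatch` (PATCHES1 `patch_rows` ∕ PATCHES2 ✓p724687 `hPatch_of_patchRows` pens); not an EX S-event (the EX display composes `hN06` and the (β)
pieces internally since S27ᴸ∕S32ᴸ); not a proof of EX, of the crux or of any summit statement; not d = 4, not infinite volume, not a mass gap, not Clay.

References: T. Bałaban, CMP 102 (1985) 277–309 [Balaban1985Variational] ((141)–(142) p.299, (44)–(47) pp.285–286, (106)–(111) p.294); CMP 99 (1985) 389–434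
[Balaban1985BackgroundPropagators] (Thm 3.11 p.416, (3.26) p.395, (3.36)–(3.39) p.397); CMP 98 (1985) 17–51 [Balaban1985Averaging] ((122)–(126) p.36).
-/

set_option autoImplicit false

noncomputable section

open scoped BigOperators Matrix.Norms.L2Operator Matrix Topology InnerProductSpace
open Filter NormedSpace

namespace Summit.QuantumFields.YangMills.Theorems.Prop7HcoSHolds

open Literature.MathematicalPhysics.QuantumFieldTheory.Balaban1983to89
open Literature.MathematicalPhysics.QuantumFieldTheory.Balaban1983to89.T3ContinuumYM3Torus
open Literature.MathematicalPhysics.QuantumFieldTheory.Balaban1983to89.T3UnitLawDensityEML (ℰp)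
open Literature.MathematicalPhysics.QuantumFieldTheory.Balaban1983to89.T3ConstrainedMinimiser (fibre)
open Literature.MathematicalPhysics.QuantumFieldTheory.Balaban1983to89.T3PrintedRegularMinimiser
open Literature.MathematicalPhysics.QuantumFieldTheory.Balaban1983to89.T3RegularMinimiser
open Literature.MathematicalPhysics.QuantumFieldTheory.Balaban1983to89.T3Thm1Carrier
open T4Continuum BlockAveraging AveragingRT ExpMeanLog BlockAveragingEMLLinearised BlockAveragingEMLLinearisedBackground BlockAveragingEMLProp2
open B7Prop1Explicit (expUnit)
open B10Eq27TorusAxialLog (pull unitsField toUField)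
open B9Eq39Adjoint (divB)
open B9TorusCalculus (torusT)
open T3SectALandauChart (emb15 eta eta_pos bgUnits In19)
open B11Eq103H1Complex (SiteL2K BondL2K laplaceAK)
open Summit.QuantumFields.YangMills.Theorems.Prop7SPrint (basePt RestrictedPrint AvgCondPrint IsLandauPrint)
open Summit.QuantumFields.YangMills.Theorems.Prop7TPrint (expHermField)
open Summit.QuantumFields.YangMills.Theorems.Prop7SectET3Transport (periodsT3)
open Summit.QuantumFields.YangMills.Theorems.Prop7SectET3HilbertLetters (W₂ toL2 toL2B DL2 DstarL2 covLapSite)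
open Summit.QuantumFields.YangMills.Theorems.Prop7SectET3WilsonHessian (DeltaEta DeltaEtaSlot)
open Summit.QuantumFields.YangMills.Theorems.Prop7SectET3CombLetters (Qkc)
open Summit.QuantumFields.YangMills.Theorems.Prop7QprimeCombL2 (RcombL2)
open Summit.QuantumFields.YangMills.Theorems.Prop7SymAvgTw (frameTw QTw CmapTw)
open Summit.QuantumFields.YangMills.Theorems.Prop7SymAvgTwSym (frameTwS CmapTwS)
open T3PrintedRegularMinimiser (RegPr)
open B9Eq39Adjoint (curl)
open B5Eq118OneStroke (iterBlockOf)
open B9Eq311L2Pairing (WL2)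
open T3LevelShift (bondShift)
open T3PrintedRegularOrbits (sites_eq)
open Summit.QuantumFields.YangMills.Theorems.Prop7SectET3HilbertLetters (toL2S frobEquiv)
open Summit.QuantumFields.YangMills.Theorems.Prop7PA2Holds (hcoS_of_hN06)
open Summit.QuantumFields.YangMills.Theorems.Prop7HN06OfPatch (hN06_of_patch hN06_of_patchRows)

variable (c₀ cB a₀ : ℕ → ℝ) [hc₀ : ∀ L : ℕ, Fact (0 < c₀ L)] [hcB : ∀ L : ℕ, Fact (0 < cB L)]

/-- ★★★ **THE GROWTH ROW (141)–(142) `hcoS` FROM THE PATCH SCHEMA `hPatch@H_door` ALONE** — binder `hPatch` = ★p1 g20 ✓`Prop7HN06OfPatch.hN06_of_patch`'s VERBATIM (the EX display's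
`hPatch` row, v2 with the floor `s₀`, at `H := H_door`); conclusion = ✓`Prop7HcoSOfNormG0DiffRow.hcoS_of_normG0_of_diffL1`'s VERBATIM (= the E′ socket `hcoS`); `ha₀` in the EX
display's spelling `∀ L, 0 < a₀ L`.  PROOF = `hcoS_of_hN06 ∘ hN06_of_patch` (✓p724900 §3 ∘ ★p1 g20's lane-II terminal knit).
[cite: Balaban1985Variational, (141)-(142) p.299; Balaban1985BackgroundPropagators, Thm 3.11 p.416, (3.26) p.395] -/
theorem hcoS_of_patch (ha₀ : ∀ L : ℕ, 0 < a₀ L)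
    (hPatch : ∀ (L : ℕ), 1 < L → ∃ ν cL cMR cHM : ℝ, 0 ≤ ν ∧ 0 ≤ cL ∧ 0 ≤ cMR ∧ 0 ≤ cHM ∧
      ∃ s₀ : ℕ, ∀ s : ℕ, s₀ ≤ s → ∃ cΦ cρCu cρN cKCu cKN cMAs cMCu cMe cHCu cHN eP : ℝ,
        0 ≤ cΦ ∧ 0 ≤ cρCu ∧ 0 ≤ cρN ∧ 0 ≤ cKCu ∧ 0 ≤ cKN ∧ 0 ≤ cMAs ∧ 0 ≤ cMCu ∧ 0 ≤ cMe ∧ 0 ≤ cHCu ∧ 0 ≤ cHN ∧ 0 < eP ∧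
        ∀ (F : T3Family), F.L = L → ∀ (n K : ℕ) (hnK : n < K) (e : ℝ) (W : GaugeField (F.P K) 0 (Matrix.specialUnitaryGroup (Fin 2) ℂ)),
          s < F.m + n → 0 < e → e ≤ eP → RegPr F n K e W →
          ∀ y : BondL2K ℂ 3 (periodsT3 F K) (c₀ F.L) W₂,
            ∃ (Z : Site (F.P K) 0 → SiteL2K ℂ 3 (periodsT3 F K) (c₀ F.L) W₂ →ₗ[ℂ] SiteL2K ℂ 3 (periodsT3 F K) (c₀ F.L) W₂)
              (ZE : Site (F.P K) 0 → BondL2K ℂ 3 (periodsT3 F K) (c₀ F.L) W₂ →ₗ[ℂ] BondL2K ℂ 3 (periodsT3 F K) (c₀ F.L) W₂)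
              (φ κs : Site (F.P K) 0 → SiteL2K ℂ 3 (periodsT3 F K) (c₀ F.L) W₂) (r : Site (F.P K) 0 → BondL2K ℂ 3 (periodsT3 F K) (c₀ F.L) W₂)
              (Ni Cui Asi ρi Φi Ki Li Mi Hρi HMi : Site (F.P K) 0 → ℝ),
              (∀ v, ∑ i, Z i v = v) ∧ (∀ f, ∑ i, ZE i f = f) ∧
              (∀ i, Z i (DstarL2 F n K (c₀ F.L) W y) = Z i (covLapSite F n K (c₀ F.L) W (φ i)) + Z i (κs i)) ∧
              (∀ i, ZE i (DL2 F n K (c₀ F.L) W (φ i)) = ZE i y - ZE i (r i)) ∧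
              (∀ i, Φi i ≤ cΦ * ((F.L : ℝ) ^ s) ^ 2 * Ni i) ∧
              (∀ i, ρi i ≤ cρCu * Cui i + cρN * e * Ni i) ∧
              (∀ i, Ki i ≤ cKCu * Cui i + cKN * e * Ni i) ∧
              (∀ i, Li i ≤ cL * ((F.L : ℝ) ^ s)⁻¹ ^ 2 * Ni i) ∧
              (∀ i, Mi i ≤ cMAs * Asi i + cMCu * Cui i + (cMR * ((F.L : ℝ) ^ s)⁻¹ ^ 2 + cMe * e) * Ni i) ∧
              (∀ i, Hρi i ≤ cHCu * Cui i + cHN * e * Ni i) ∧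
              (∀ i, HMi i ≤ cHM * ((F.L : ℝ) ^ s)⁻¹ ^ 2 * Ni i) ∧
              (∑ i, Ni i ≤ ν * ‖y‖ ^ 2) ∧
              (∑ i, Cui i ≤ ν * (RCLike.re ⟪y, DeltaEtaSlot F n K (c₀ F.L) W y⟫_ℂ + 1029 * e * ‖y‖ ^ 2)) ∧
              (∑ i, Asi i ≤ ν * ((c₀ F.L / cB F.L) * ((F.L : ℝ) ^ (K - n)) ^ 3 * ‖Qkc F n K hnK.le (c₀ F.L) (cB F.L) W y‖ ^ 2)) ∧
              (‖∑ i, ZE i (r i)‖ ^ 2 ≤ ν * ∑ i, ρi i) ∧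
              (‖∑ i, (DL2 F n K (c₀ F.L) W (Z i (φ i)) - ZE i (DL2 F n K (c₀ F.L) W (φ i)))‖ ^ 2 ≤ ν * ∑ i, Mi i) ∧
              ((fun (F : T3Family) (n K : ℕ) (W : GaugeField (F.P K) 0 (Matrix.specialUnitaryGroup (Fin 2) ℂ)) (f : BondL2K ℂ 3 (periodsT3 F K) (c₀ F.L) W₂) =>
                c₀ F.L * ((F.L : ℝ) ^ (K - n)) ^ 2 * (∑ x : Site (F.P K) 0, ∑ μ : Fin (F.P K).d, ∑ ν : Fin (F.P K).d,
                (if μ < ν then ∑ j : Fin 2, ∑ k : Fin 2,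
                ‖(curl (torusT (F.P K) 0) (fun κ z => unitsField (toUField W) ⟨z, κ⟩) (fun κ z => (toL2 F K (c₀ F.L)).symm f ⟨z, κ⟩) μ ν x) j k‖ ^ 2 else 0))
                + ‖DstarL2 F n K (c₀ F.L) W f‖ ^ 2)
                  F n K W (∑ i, ZE i (r i)) ≤ ν * ∑ i, Hρi i) ∧
              ((fun (F : T3Family) (n K : ℕ) (W : GaugeField (F.P K) 0 (Matrix.specialUnitaryGroup (Fin 2) ℂ)) (f : BondL2K ℂ 3 (periodsT3 F K) (c₀ F.L) W₂) =>
                c₀ F.L * ((F.L : ℝ) ^ (K - n)) ^ 2 * (∑ x : Site (F.P K) 0, ∑ μ : Fin (F.P K).d, ∑ ν : Fin (F.P K).d,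
                (if μ < ν then ∑ j : Fin 2, ∑ k : Fin 2,
                ‖(curl (torusT (F.P K) 0) (fun κ z => unitsField (toUField W) ⟨z, κ⟩) (fun κ z => (toL2 F K (c₀ F.L)).symm f ⟨z, κ⟩) μ ν x) j k‖ ^ 2 else 0))
                + ‖DstarL2 F n K (c₀ F.L) W f‖ ^ 2)
                  F n K W (∑ i, (DL2 F n K (c₀ F.L) W (Z i (φ i)) - ZE i (DL2 F n K (c₀ F.L) W (φ i)))) ≤ ν * ∑ i, HMi i) ∧
              (‖∑ i, (covLapSite F n K (c₀ F.L) W (Z i (φ i)) - Z i (covLapSite F n K (c₀ F.L) W (φ i)))‖ ^ 2 ≤ ν * ∑ i, Li i) ∧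
              (‖∑ i, Z i (κs i)‖ ^ 2 ≤ ν * ∑ i, Ki i) ∧
              (‖∑ i, Z i (φ i)‖ ^ 2 ≤ ν * ∑ i, Φi i)) :
    ∀ (L : ℕ), 1 < L → ∀ (B₁' : ℝ), 0 < B₁' → ∃ e₇ : ℝ, 0 < e₇ ∧
      ∀ (F : T3Family), F.L = L → ∀ (n K : ℕ) (hnK : n < K) (e : ℝ) (V : GaugeField (F.P n) 0 (Matrix.specialUnitaryGroup (Fin 2) ℂ))
        (W : GaugeField (F.P K) 0 (Matrix.specialUnitaryGroup (Fin 2) ℂ)) (X : PBond (F.P K) 0 → Matrix (Fin 2) (Fin 2) ℂ),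
        0 < e → e ≤ e₇ → W ∈ regFibrePr F n K hnK.le e V →
        (∀ γ : ℝ → GaugeField (F.P K) 0 (Matrix.specialUnitaryGroup (Fin 2) ℂ), γ 0 = W → (∀ t, γ t ∈ fibre F ℰp n K hnK.le V) →
          (∀ b, DifferentiableAt ℝ (fun t => ((γ t b : Matrix.specialUnitaryGroup (Fin 2) ℂ) : Matrix (Fin 2) (Fin 2) ℂ)) 0) →
            deriv (fun t => wilsonAction4 (γ t)) 0 = 0) →
        In19 F n K (2 * B₁' * e) W (expHermField X) X → AvgCondPrint F n K hnK.le V W X → IsLandauPrint F n K W X →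
          wilsonAction4 W ≤ wilsonAction4 (emb15 W (expHermField X)) :=
  hcoS_of_hN06 c₀ cB a₀ (fun L => (ha₀ L).le) (hN06_of_patch c₀ cB a₀ (fun L _ => ha₀ L) hPatch)

/-- ★★★ **THE GROWTH ROW (141)–(142) `hcoS` FROM ONE CLOSED PER-PATCH SCHEMA `hP1`** — binder = ★p1 g20 ✓`Prop7HN06OfPatch.hN06_of_patchRows`'s schema binder VERBATIM (= px12 g9
✓p724687 `Prop7DivRecoveryAssemblyPatches2.hPatch_of_patchRows`'s `hP1`, the PATCHES1 target `patch_rows` of px9 g8 ∕ w1-19200 g16's chain); conclusion = `hcoS` VERBATIM.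
PROOF = `hcoS_of_hN06 ∘ hN06_of_patchRows`.  When `patch_rows` lands, `hcoS` is ONE application away (`hcoS_of_patchRows … (patch_rows …)`), hypothesis-free up to `c₀ cB a₀ ha₀`.
[cite: Balaban1985Variational, (141)-(142) p.299; Balaban1985BackgroundPropagators, Thm 3.11 p.416, (3.26) p.395] -/
theorem hcoS_of_patchRows (ha₀ : ∀ L : ℕ, 0 < a₀ L)
    (hP1 : ∀ (L : ℕ), 1 < L → ∃ cL cMR cHM : ℝ, 0 ≤ cL ∧ 0 ≤ cMR ∧ 0 ≤ cHM ∧ ∃ s₀ : ℕ, ∀ s : ℕ, s₀ ≤ s →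
      ∃ cΦ cρCu cρN cKCu cKN cMAs cMCu cMe cHCu cHN eP : ℝ,
        0 ≤ cΦ ∧ 0 ≤ cρCu ∧ 0 ≤ cρN ∧ 0 ≤ cKCu ∧ 0 ≤ cKN ∧ 0 ≤ cMAs ∧ 0 ≤ cMCu ∧ 0 ≤ cMe ∧ 0 ≤ cHCu ∧ 0 ≤ cHN ∧ 0 < eP ∧
        ∀ (F : T3Family), F.L = L → ∀ (n K : ℕ) (hnK : n < K) (e : ℝ) (W : GaugeField (F.P K) 0 (Matrix.specialUnitaryGroup (Fin 2) ℂ)),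
          s < F.m + n → 0 < e → e ≤ eP → RegPr F n K e W →
          ∀ (y : BondL2K ℂ 3 (periodsT3 F K) (c₀ F.L) W₂),
          ∀ g ∈ (Fintype.piFinset fun _ : Fin 3 => Finset.range (2 * F.L ^ (F.m + n - s))),
          ∀ (ζc : Site (F.P K) 0 → ℝ) (Z : SiteL2K ℂ 3 (periodsT3 F K) (c₀ F.L) W₂ →ₗ[ℂ] SiteL2K ℂ 3 (periodsT3 F K) (c₀ F.L) W₂)
            (ZE : BondL2K ℂ 3 (periodsT3 F K) (c₀ F.L) W₂ →ₗ[ℂ] BondL2K ℂ 3 (periodsT3 F K) (c₀ F.L) W₂),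
            (∀ x, 0 ≤ ζc x ∧ ζc x ≤ 1) →
            (∀ x, ζc x ≠ 0 → ∀ κ : Fin 3, min (x κ - ((g κ * (F.L ^ s * F.L ^ (K - n)) : ℕ) : ZMod ((F.P K).sitesPerDir 0))).val (((g κ * (F.L ^ s * F.L ^ (K - n)) : ℕ) : ZMod ((F.P K).sitesPerDir 0)) - x κ).val < F.L ^ s * F.L ^ (K - n)) →
            (∀ x (μ : Fin 3), |ζc (x.shift μ) - ζc x| ≤ 3 / 2 / ((F.L : ℝ) ^ s * (F.L : ℝ) ^ (K - n)) ∧ |ζc (x.unshift μ) - ζc x| ≤ 3 / 2 / ((F.L : ℝ) ^ s * (F.L : ℝ) ^ (K - n))) →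
            (∀ x (μ : Fin 3), |ζc (x.shift μ) + ζc (x.unshift μ) - 2 * ζc x| ≤ 6 / ((F.L : ℝ) ^ s * (F.L : ℝ) ^ (K - n)) ^ 2) →
            (∀ φ x, (toL2S F K (c₀ F.L)).symm (Z φ) x = ζc x • (toL2S F K (c₀ F.L)).symm φ x) →
            (∀ f b, (toL2 F K (c₀ F.L)).symm (ZE f) b = ζc b.src • (toL2 F K (c₀ F.L)).symm f b) →
            ∃ (φ κs : SiteL2K ℂ 3 (periodsT3 F K) (c₀ F.L) W₂) (r : BondL2K ℂ 3 (periodsT3 F K) (c₀ F.L) W₂) (N Cu As : ℝ),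
              Z (DstarL2 F n K (c₀ F.L) W y) = Z (covLapSite F n K (c₀ F.L) W φ) + Z κs ∧
              ZE (DL2 F n K (c₀ F.L) W φ) = ZE y - ZE r ∧
              ‖φ‖ ^ 2 ≤ cΦ * ((F.L : ℝ) ^ s) ^ 2 * N ∧
              ‖r‖ ^ 2 ≤ cρCu * Cu + cρN * e * N ∧
              ‖Z κs‖ ^ 2 ≤ cKCu * Cu + cKN * e * N ∧
              ‖covLapSite F n K (c₀ F.L) W (Z φ) - Z (covLapSite F n K (c₀ F.L) W φ)‖ ^ 2 ≤ cL * ((F.L : ℝ) ^ s)⁻¹ ^ 2 * N ∧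
              ‖DL2 F n K (c₀ F.L) W (Z φ) - ZE (DL2 F n K (c₀ F.L) W φ)‖ ^ 2
                ≤ cMAs * As + cMCu * Cu + (cMR * ((F.L : ℝ) ^ s)⁻¹ ^ 2 + cMe * e) * N ∧
              (c₀ F.L * ((F.L : ℝ) ^ (K - n)) ^ 2 * (∑ x : Site (F.P K) 0, ∑ μ : Fin (F.P K).d, ∑ ν : Fin (F.P K).d, (if μ < ν then ∑ j : Fin 2, ∑ k : Fin 2, ‖(curl (torusT (F.P K) 0) (fun κ z => unitsField (toUField W) ⟨z, κ⟩) (fun κ z => (toL2 F K (c₀ F.L)).symm (ZE r) ⟨z, κ⟩) μ ν x) j k‖ ^ 2 else 0)) + ‖DstarL2 F n K (c₀ F.L) W (ZE r)‖ ^ 2)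
                ≤ cHCu * Cu + cHN * e * N ∧
              (c₀ F.L * ((F.L : ℝ) ^ (K - n)) ^ 2 * (∑ x : Site (F.P K) 0, ∑ μ : Fin (F.P K).d, ∑ ν : Fin (F.P K).d, (if μ < ν then ∑ j : Fin 2, ∑ k : Fin 2, ‖(curl (torusT (F.P K) 0) (fun κ z => unitsField (toUField W) ⟨z, κ⟩) (fun κ z => (toL2 F K (c₀ F.L)).symm (DL2 F n K (c₀ F.L) W (Z φ) - ZE (DL2 F n K (c₀ F.L) W φ)) ⟨z, κ⟩) μ ν x) j k‖ ^ 2 else 0)) + ‖DstarL2 F n K (c₀ F.L) W (DL2 F n K (c₀ F.L) W (Z φ) - ZE (DL2 F n K (c₀ F.L) W φ))‖ ^ 2)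
                ≤ cHM * ((F.L : ℝ) ^ s)⁻¹ ^ 2 * N ∧
              N ≤ ∑ b ∈ Finset.univ.filter (fun b : PBond (F.P K) 0 => ∀ κ : Fin 3,
                  min ((iterBlockOf (K - n) b.src) κ - ((g κ * F.L ^ s : ℕ) : ZMod ((F.P K).sitesPerDir (K - n)))).val
                    ((((g κ * F.L ^ s : ℕ) : ZMod ((F.P K).sitesPerDir (K - n)))) - (iterBlockOf (K - n) b.src) κ).val ≤ 2 * F.L ^ s + 2), c₀ F.L * ‖(frobEquiv.symm ((toL2 F K (c₀ F.L)).symm y b) : W₂)‖ ^ 2 ∧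
              Cu ≤ ∑ x ∈ Finset.univ.filter (fun x : Site (F.P K) 0 => ∀ κ : Fin 3,
                  min ((iterBlockOf (K - n) x) κ - ((g κ * F.L ^ s : ℕ) : ZMod ((F.P K).sitesPerDir (K - n)))).val
                    ((((g κ * F.L ^ s : ℕ) : ZMod ((F.P K).sitesPerDir (K - n)))) - (iterBlockOf (K - n) x) κ).val ≤ 2 * F.L ^ s + 2),
                c₀ F.L * ((F.L : ℝ) ^ (K - n)) ^ 2 * ∑ μ : Fin (F.P K).d, ∑ ν : Fin (F.P K).d, (if μ < ν then ∑ j : Fin 2, ∑ k : Fin 2,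
                  ‖(curl (torusT (F.P K) 0) (fun κ z => unitsField (toUField W) ⟨z, κ⟩) (fun κ z => (toL2 F K (c₀ F.L)).symm y ⟨z, κ⟩) μ ν x) j k‖ ^ 2 else 0) ∧
              As ≤ ∑ c ∈ Finset.univ.filter (fun c : PBond (F.P K) (K - n) => ∀ κ : Fin 3,
                  min ((c.src) κ - ((g κ * F.L ^ s : ℕ) : ZMod ((F.P K).sitesPerDir (K - n)))).val
                    ((((g κ * F.L ^ s : ℕ) : ZMod ((F.P K).sitesPerDir (K - n)))) - (c.src) κ).val ≤ 2 * F.L ^ s + 2),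
                (c₀ F.L / cB F.L) * ((F.L : ℝ) ^ (K - n)) ^ 3 * (cB F.L * ‖WL2.equiv ℂ (fun _ : PBond (F.P n) 0 => cB F.L) W₂
                  (Qkc F n K hnK.le (c₀ F.L) (cB F.L) W y) ((bondShift (sites_eq F n K hnK.le)).symm c)‖ ^ 2)) :
    ∀ (L : ℕ), 1 < L → ∀ (B₁' : ℝ), 0 < B₁' → ∃ e₇ : ℝ, 0 < e₇ ∧
      ∀ (F : T3Family), F.L = L → ∀ (n K : ℕ) (hnK : n < K) (e : ℝ) (V : GaugeField (F.P n) 0 (Matrix.specialUnitaryGroup (Fin 2) ℂ))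
        (W : GaugeField (F.P K) 0 (Matrix.specialUnitaryGroup (Fin 2) ℂ)) (X : PBond (F.P K) 0 → Matrix (Fin 2) (Fin 2) ℂ),
        0 < e → e ≤ e₇ → W ∈ regFibrePr F n K hnK.le e V →
        (∀ γ : ℝ → GaugeField (F.P K) 0 (Matrix.specialUnitaryGroup (Fin 2) ℂ), γ 0 = W → (∀ t, γ t ∈ fibre F ℰp n K hnK.le V) →
          (∀ b, DifferentiableAt ℝ (fun t => ((γ t b : Matrix.specialUnitaryGroup (Fin 2) ℂ) : Matrix (Fin 2) (Fin 2) ℂ)) 0) →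
            deriv (fun t => wilsonAction4 (γ t)) 0 = 0) →
        In19 F n K (2 * B₁' * e) W (expHermField X) X → AvgCondPrint F n K hnK.le V W X → IsLandauPrint F n K W X →
          wilsonAction4 W ≤ wilsonAction4 (emb15 W (expHermField X)) :=
  hcoS_of_hN06 c₀ cB a₀ (fun L => (ha₀ L).le) (hN06_of_patchRows c₀ cB a₀ (fun L _ => ha₀ L) hP1)

end Summit.QuantumFields.YangMills.Theorems.Prop7HcoSHolds

end
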